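import Summits.Langlands.Langlands.Theorems.PicardMuOrdinaryMuOrdinaryFamilyRTDefs
import Literature.NumberTheory.GaloisRepresentations.PadicIntermediateFieldIntegers

/-!
# The coefficient ring `𝒪₀ = ℤ₃[ζ₃] ⊆ ℚ̄₃` of the Picard point (line `free-seed-smooth-rt`,
# crux `MuOrdinaryFamilyRT`, stmt-Langlands-13757)

Helper file for the conditional stub `stub_point_of` of the registered skeleton
`Cruxes/MuOrdinaryFamilyRT/Lines/free-seed-smooth-rt.lean`.  For an isomorphism `ι : ℚ̄₃ ≃ ℂ` and
an embedding `e : K = ℚ(ζ₃) → ℂ` we pin down the field `E₀ = ℚ₃(ι⁻¹ e ζ₃) ⊆ ℚ̄₃` generated by the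
Picard Frobenius traces `ι⁻¹ e(a_𝔭(f))` and its ring of integers `𝒪₀ = O₀ ι e`
(`intermediateFieldIntegers`, norm `≤ 1`), and PROVE the structure demanded by `PointData.𝒪`:
`𝒪₀ = ℤ₃ ⊕ ℤ₃ π` with `π = ζ₃ - 1`, `π² = -3 ζ₃` (`exists_padicInt_add_mul_pi`), so `𝒪₀` is a
complete discrete valuation ring, finite over `ℤ₃`, with residue field `𝔽₃`
(`algebraMap_O₀_ZMod_surjective`, `ker_algebraMap_O₀_ZMod`), embedded in `ℚ̄₃` by `j₀`
compatibly with `ℤ₃` (`j₀_comp_algebraMap`); and `ι⁻¹ e(K) ⊆ E₀` (`mem_E₀_of_K`).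
Everything here is unconditional.
-/

-- `Summit.Langlands.Langlands.…` (summit = sub-problem name, D-0017 layout) trips `dupNamespace` on every decl.
set_option linter.dupNamespace false

namespace Summit.Langlands.Langlands.Cruxes.MuOrdinaryFamilyRT.FreeSeedSmoothRt

open scoped NumberField Polynomial
open Polynomial IsLocalRing
open Literature.NumberTheory.GaloisRepresentations

noncomputable section

/-! ### `ζ₃` in `K` and in `ℚ̄₃` -/

/-- `K = ℚ(ζ₃)` is the third cyclotomic extension of `ℚ` (Mathlib's instance, whose `NeZero`
side condition instance search does not find here; kept a theorem, used via `haveI`). -/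
theorem isCyclotomicExtensionK : IsCyclotomicExtension {3} ℚ K :=
  CyclotomicField.isCyclotomicExtension 3 ℚ

/-- A primitive cube root of unity `ζ ∈ K`. -/
def zetaK : K :=
  haveI := isCyclotomicExtensionK
  IsCyclotomicExtension.zeta 3 ℚ K

/-- `ζ` is a primitive cube root of unity. -/
theorem isPrimitiveRoot_zetaK : IsPrimitiveRoot zetaK 3 :=
  haveI := isCyclotomicExtensionK
  IsCyclotomicExtension.zeta_spec 3 ℚ K

/-- Every element of `K` is a rational polynomial in `ζ`. -/
theorem exists_aeval_zetaK_eq (x : K) : ∃ p : ℚ[X], aeval zetaK p = x := by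
  haveI := isCyclotomicExtensionK
  have hx : x ∈ (⊤ : Subalgebra ℚ K) := Algebra.mem_top
  rw [← IsCyclotomicExtension.adjoin_primitive_root_eq_top isPrimitiveRoot_zetaK,
    Algebra.adjoin_singleton_eq_range_aeval] at hx
  obtain ⟨p, hp⟩ := hx
  exact ⟨p, hp⟩

variable (ι : PadicAlgCl 3 ≃+* ℂ) (e : K →+* ℂ)

/-- `ζ₃ = ι⁻¹(e(ζ)) ∈ ℚ̄₃`. -/
def zeta3 : PadicAlgCl 3 := ι.symm (e zetaK)

/-- `ζ₃` is a primitive cube root of unity in `ℚ̄₃`. -/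
theorem isPrimitiveRoot_zeta3 : IsPrimitiveRoot (zeta3 ι e) 3 :=
  (isPrimitiveRoot_zetaK.map_of_injective e.injective).map_of_injective ι.symm.injective

/-- `ζ₃² + ζ₃ + 1 = 0`. -/
theorem zeta3_sq_add : zeta3 ι e ^ 2 + zeta3 ι e + 1 = 0 := by
  have h3 : zeta3 ι e ^ 3 = 1 := (isPrimitiveRoot_zeta3 ι e).pow_eq_one
  have h1 : zeta3 ι e ≠ 1 := (isPrimitiveRoot_zeta3 ι e).ne_one (by norm_num)
  have : (zeta3 ι e - 1) * (zeta3 ι e ^ 2 + zeta3 ι e + 1) = 0 := by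
    rw [← sub_eq_zero] at h3
    rw [← h3]; ring
  exact (mul_eq_zero.mp this).resolve_left (sub_ne_zero.mpr h1)

/-- `‖ζ₃‖ = 1`. -/
theorem norm_zeta3 : ‖zeta3 ι e‖ = 1 := by
  have h3 : ‖zeta3 ι e‖ ^ 3 = 1 := by
    rw [← norm_pow, (isPrimitiveRoot_zeta3 ι e).pow_eq_one, norm_one]
  exact (pow_eq_one_iff_of_nonneg (norm_nonneg _) (by norm_num)).mp h3

/-- `ζ₃` is integral over `ℚ₃`. -/
theorem isIntegral_zeta3 : IsIntegral ℚ_[3] (zeta3 ι e) :=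
  ((isPrimitiveRoot_zeta3 ι e).isIntegral (by norm_num)).tower_top

/-! ### The field `E₀ = ℚ₃(ζ₃)` -/

/-- `E₀ = ℚ₃(ζ₃) ⊆ ℚ̄₃`. -/
def E₀ : IntermediateField ℚ_[3] (PadicAlgCl 3) := IntermediateField.adjoin ℚ_[3] {zeta3 ι e}

/-- `E₀/ℚ₃` is finite. -/
instance instFiniteDimensionalE₀ : FiniteDimensional ℚ_[3] (E₀ ι e) :=
  IntermediateField.adjoin.finiteDimensional (isIntegral_zeta3 ι e)

/-- `ζ₃ ∈ E₀`. -/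
theorem zeta3_mem_E₀ : zeta3 ι e ∈ E₀ ι e := IntermediateField.mem_adjoin_simple_self ℚ_[3] _

/-- **`ι⁻¹ e(K) ⊆ E₀`**: the Picard traces `ι⁻¹ e(a_𝔭(f))` lie in `E₀`. -/
theorem mem_E₀_of_K (x : K) : ι.symm (e x) ∈ E₀ ι e := by
  obtain ⟨p, rfl⟩ := exists_aeval_zetaK_eq x
  set g : K →+* PadicAlgCl 3 := ι.symm.toRingHom.comp e with hg
  have hrat : g.comp (algebraMap ℚ K) = (algebraMap ℚ_[3] (PadicAlgCl 3)).comp (algebraMap ℚ ℚ_[3]) :=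
    RingHom.ext_rat _ _
  have h1 : ι.symm (e (aeval zetaK p)) = aeval (zeta3 ι e) (p.map (algebraMap ℚ ℚ_[3])) := by
    change g (aeval zetaK p) = _
    rw [aeval_def, hom_eval₂, hrat, aeval_def, eval₂_map]
    rfl
  rw [h1]
  exact IntermediateField.algebra_adjoin_le_adjoin _ _ (Polynomial.aeval_mem_adjoin_singleton _ _)

/-- Every element of `E₀` is `a + b ζ₃` with `a, b ∈ ℚ₃` (`[E₀ : ℚ₃] ≤ 2`). -/
theorem exists_eq_add_mul_zeta3 {y : PadicAlgCl 3} (hy : y ∈ E₀ ι e) :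
    ∃ a b : ℚ_[3], y = a + b * zeta3 ι e := by
  have hy' : y ∈ (E₀ ι e).toSubalgebra := hy
  rw [E₀, IntermediateField.adjoin_simple_toSubalgebra_of_isAlgebraic (isIntegral_zeta3 ι e).isAlgebraic,
    Algebra.adjoin_singleton_eq_range_aeval] at hy'
  obtain ⟨p, rfl⟩ := hy'
  set q : ℚ_[3][X] := X ^ 2 + X + 1 with hq
  have hqm : q.Monic := by rw [hq]; monicity!
  have hroot : aeval (zeta3 ι e) q = 0 := by
    simp only [hq, map_add, map_pow, aeval_X, map_one]
    exact zeta3_sq_add ι e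
  have hq2 : q.natDegree = 2 := by rw [hq]; compute_degree!
  have hdeg : (p %ₘ q).natDegree ≤ 1 := by
    have h := natDegree_modByMonic_lt p hqm (fun h1 => by simp [h1] at hq2)
    omega
  obtain ⟨b, a, hab⟩ := exists_eq_X_add_C_of_natDegree_le_one hdeg
  refine ⟨a, b, ?_⟩
  change aeval (zeta3 ι e) p = _
  rw [← aeval_modByMonic_eq_self_of_root (p := p) hroot, hab]
  simp only [map_add, map_mul, aeval_C, aeval_X]
  ring

/-! ### The uniformizer `π = ζ₃ - 1` and the shape of the unit ball of `E₀` -/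

/-- `π = ζ₃ - 1`. -/
def piE : PadicAlgCl 3 := zeta3 ι e - 1

/-- `π² = -3 ζ₃`. -/
theorem piE_sq : piE ι e ^ 2 = -3 * zeta3 ι e := by
  have h := zeta3_sq_add ι e
  rw [piE]
  linear_combination h

/-- `‖π‖² = 3⁻¹`. -/
theorem norm_piE_sq : ‖piE ι e‖ ^ 2 = 3⁻¹ := by
  rw [← norm_pow, piE_sq, norm_mul, norm_neg, norm_zeta3, mul_one]
  have h := Padic.norm_p (p := 3)
  have h' : ‖algebraMap ℚ_[3] (PadicAlgCl 3) ((3 : ℕ) : ℚ_[3])‖ = ‖((3 : ℕ) : ℚ_[3])‖ :=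
    norm_algebraMap' _ _
  rw [map_natCast] at h'
  push_cast at h h'
  rw [h', h]

/-- `‖π‖ < 1`. -/
theorem norm_piE_lt_one : ‖piE ι e‖ < 1 := by
  have h := norm_piE_sq ι e
  nlinarith [norm_nonneg (piE ι e)]

/-- `π ∈ E₀`. -/
theorem piE_mem_E₀ : piE ι e ∈ E₀ ι e := (E₀ ι e).sub_mem (zeta3_mem_E₀ ι e) (E₀ ι e).one_mem

/-- For `b ∈ ℚ₃`: `‖b‖ · ‖π‖ ≤ 1` forces `‖b‖ ≤ 1` (the value groups `3^ℤ` and `3^{ℤ + 1/2}` are disjoint). -/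
theorem norm_le_one_of_norm_mul_norm_piE_le_one {b : ℚ_[3]} (h : ‖b‖ * ‖piE ι e‖ ≤ 1) : ‖b‖ ≤ 1 := by
  by_cases hb : b = 0
  · simp [hb]
  have hsq : ‖b‖ ^ 2 * 3⁻¹ ≤ 1 := by
    rw [← norm_piE_sq, ← mul_pow]
    exact pow_le_one₀ (mul_nonneg (norm_nonneg _) (norm_nonneg _)) h
  rw [Padic.norm_eq_zpow_neg_valuation hb] at hsq ⊢
  push_cast at hsq ⊢
  have h3 : (1 : ℝ) < 3 := by norm_num
  have hcalc : ((3 : ℝ) ^ (-b.valuation)) ^ 2 * 3⁻¹ = (3 : ℝ) ^ (-2 * b.valuation - 1) := by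
    rw [← zpow_natCast, ← zpow_mul, ← zpow_neg_one, ← zpow_add₀ (by norm_num : (3 : ℝ) ≠ 0)]
    congr 1
    ring
  rw [hcalc, ← zpow_zero (3 : ℝ), zpow_le_zpow_iff_right₀ h3] at hsq
  rw [← zpow_zero (3 : ℝ), zpow_le_zpow_iff_right₀ h3]
  omega

/-- For `a, b ∈ ℚ₃` the norms `‖a‖ ∈ 3^ℤ` and `‖b π‖ ∈ 3^{ℤ+1/2}` never coincide unless `b = 0`. -/
theorem eq_zero_of_norm_eq_norm_mul_piE {a b : ℚ_[3]} (h : ‖a‖ = ‖b‖ * ‖piE ι e‖) : b = 0 := by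
  by_contra hb
  have ha : a ≠ 0 := by
    rintro rfl
    rw [norm_zero, eq_comm, mul_eq_zero] at h
    rcases h with h | h
    · exact hb (norm_eq_zero.mp h)
    · exact (norm_piE_lt_one ι e).ne' (by
        have := norm_piE_sq ι e
        rw [h] at this
        norm_num at this)
  have hsq : ‖a‖ ^ 2 = ‖b‖ ^ 2 * 3⁻¹ := by rw [h, mul_pow, norm_piE_sq]
  rw [Padic.norm_eq_zpow_neg_valuation ha, Padic.norm_eq_zpow_neg_valuation hb] at hsq
  push_cast at hsq
  rw [← zpow_natCast, ← zpow_mul, ← zpow_natCast, ← zpow_mul, ← zpow_neg_one,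
    ← zpow_add₀ (by norm_num : (3 : ℝ) ≠ 0)] at hsq
  have hinj := zpow_right_injective₀ (by norm_num : (0 : ℝ) < 3) (by norm_num : (3 : ℝ) ≠ 1) hsq
  push_cast at hinj
  omega

/-- **The unit ball of `E₀` is `ℤ₃ + ℤ₃ π`**: if `‖a + b π‖ ≤ 1` (`a, b ∈ ℚ₃`) then `‖a‖, ‖b‖ ≤ 1`. -/
theorem norm_le_one_of_norm_add_mul_piE_le_one {a b : ℚ_[3]}
    (h : ‖(a : PadicAlgCl 3) + b * piE ι e‖ ≤ 1) : ‖a‖ ≤ 1 ∧ ‖b‖ ≤ 1 := by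
  have hA : ‖(a : PadicAlgCl 3)‖ = ‖a‖ := PadicAlgCl.norm_extends 3 a
  have hB : ‖(b : PadicAlgCl 3) * piE ι e‖ = ‖b‖ * ‖piE ι e‖ := by
    rw [norm_mul, PadicAlgCl.norm_extends]
  by_cases hAB : ‖(a : PadicAlgCl 3)‖ = ‖(b : PadicAlgCl 3) * piE ι e‖
  · have hb : b = 0 := eq_zero_of_norm_eq_norm_mul_piE ι e (by rw [← hA, hAB, hB])
    subst hb
    rw [map_zero, zero_mul, add_zero, hA] at h
    exact ⟨h, by simp⟩
  · have hmax := IsUltrametricDist.norm_add_eq_max_of_norm_ne_norm hAB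
    rw [hmax, max_le_iff, hA, hB] at h
    exact ⟨h.1, norm_le_one_of_norm_mul_norm_piE_le_one ι e h.2⟩

/-- Every element of `E₀` is `a + b π` with `a, b ∈ ℚ₃`. -/
theorem exists_eq_add_mul_piE {y : PadicAlgCl 3} (hy : y ∈ E₀ ι e) :
    ∃ a b : ℚ_[3], y = a + b * piE ι e := by
  obtain ⟨a, b, rfl⟩ := exists_eq_add_mul_zeta3 ι e hy
  refine ⟨a + b, b, ?_⟩
  rw [piE]
  push_cast
  ring

/-! ### The ring `𝒪₀ = 𝒪_{E₀} = ℤ₃[ζ₃]` -/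

/-- `𝒪₀ = 𝒪_{E₀}`, the closed unit ball of `E₀` (a complete discrete valuation ring). -/
abbrev O₀ : Type := intermediateFieldIntegers 3 (E₀ ι e)

/-- `𝒪₀` is a discrete valuation ring. -/
instance instIsDiscreteValuationRingO₀ : IsDiscreteValuationRing (O₀ ι e) where
  not_a_field' := intermediateFieldIntegers.maximalIdeal_ne_bot _

/-- The inclusion `j₀ : 𝒪₀ → ℚ̄₃`. -/
def j₀ : O₀ ι e →+* PadicAlgCl 3 :=
  (algebraMap (E₀ ι e) (PadicAlgCl 3)).comp (algebraMap (O₀ ι e) (E₀ ι e))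

/-- `j₀ x = x` in `ℚ̄₃`. -/
theorem j₀_apply (x : O₀ ι e) : j₀ ι e x = ((x : E₀ ι e) : PadicAlgCl 3) := rfl

/-- `j₀` is injective. -/
theorem j₀_injective : Function.Injective (j₀ ι e) := fun _ _ h => Subtype.ext (Subtype.ext h)

/-- `‖j₀ x‖ ≤ 1`. -/
theorem norm_j₀_le_one (x : O₀ ι e) : ‖j₀ ι e x‖ ≤ 1 := (mem_intermediateFieldIntegers_iff _ _).mp x.2

/-- `x ∈ 𝔪_{𝒪₀} ↔ ‖x‖ < 1`. -/
theorem mem_maximalIdeal_O₀_iff (x : O₀ ι e) : x ∈ maximalIdeal (O₀ ι e) ↔ ‖j₀ ι e x‖ < 1 :=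
  intermediateFieldIntegers.mem_maximalIdeal_iff _ x

/-- `π` as an element of `𝒪₀`. -/
def piO : O₀ ι e :=
  ⟨⟨piE ι e, piE_mem_E₀ ι e⟩, (mem_intermediateFieldIntegers_iff _ _).mpr (norm_piE_lt_one ι e).le⟩

/-- `j₀ π = π`. -/
@[simp] theorem j₀_piO : j₀ ι e (piO ι e) = piE ι e := rfl

/-- The structure map `ℤ₃ → 𝒪₀` (restriction of `ℚ₃ ⊆ E₀`). -/
def padicIntToO₀ : ℤ_[3] →+* O₀ ι e :=
  ((algebraMap ℚ_[3] (E₀ ι e)).comp (algebraMap ℤ_[3] ℚ_[3])).codRestrict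
    (intermediateFieldIntegers 3 (E₀ ι e)) fun a => by
      rw [mem_intermediateFieldIntegers_iff]
      change ‖((algebraMap ℚ_[3] (E₀ ι e) (a : ℚ_[3]) : E₀ ι e) : PadicAlgCl 3)‖ ≤ 1
      rw [IntermediateField.coe_algebraMap_apply, PadicAlgCl.norm_extends]
      exact a.2

/-- `𝒪₀` is a `ℤ₃`-algebra. -/
instance instAlgebraPadicIntO₀ : Algebra ℤ_[3] (O₀ ι e) := (padicIntToO₀ ι e).toAlgebra

/-- `j₀ ∘ (ℤ₃ → 𝒪₀) = (ℤ₃ → ℚ̄₃)`, pointwise. -/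
@[simp] theorem j₀_algebraMap (a : ℤ_[3]) :
    j₀ ι e (algebraMap ℤ_[3] (O₀ ι e) a) = ((a : ℚ_[3]) : PadicAlgCl 3) := rfl

/-- `j₀ ∘ (ℤ₃ → 𝒪₀) = (ℤ₃ → ℚ̄₃)`. -/
theorem j₀_comp_algebraMap : (j₀ ι e).comp (algebraMap ℤ_[3] (O₀ ι e)) = algebraMap ℤ_[3] (PadicAlgCl 3) :=
  RingHom.ext fun a => j₀_algebraMap ι e a

/-- **`𝒪₀ = ℤ₃ ⊕ ℤ₃ π`.** -/
theorem exists_padicInt_add_mul_piO (x : O₀ ι e) :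
    ∃ a b : ℤ_[3], x = algebraMap ℤ_[3] (O₀ ι e) a + algebraMap ℤ_[3] (O₀ ι e) b * piO ι e := by
  obtain ⟨a, b, hab⟩ := exists_eq_add_mul_piE ι e (x : E₀ ι e).2
  have hle := norm_j₀_le_one ι e x
  rw [j₀_apply, hab] at hle
  obtain ⟨ha, hb⟩ := norm_le_one_of_norm_add_mul_piE_le_one ι e hle
  refine ⟨⟨a, ha⟩, ⟨b, hb⟩, j₀_injective ι e ?_⟩
  rw [j₀_apply, hab, map_add, map_mul, j₀_algebraMap, j₀_algebraMap, j₀_piO]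

/-- `𝒪₀` is finite over `ℤ₃` (generated by `1, π`). -/
instance instModuleFiniteO₀ : Module.Finite ℤ_[3] (O₀ ι e) := by
  classical
  refine Module.finite_def.mpr ⟨{1, piO ι e}, eq_top_iff.mpr fun x _ => ?_⟩
  obtain ⟨a, b, rfl⟩ := exists_padicInt_add_mul_piO ι e x
  rw [Finset.coe_insert, Finset.coe_singleton]
  refine Submodule.add_mem _ ?_ ?_
  · rw [Algebra.algebraMap_eq_smul_one]
    exact Submodule.smul_mem _ _ (Submodule.subset_span (Set.mem_insert _ _))
  · rw [← Algebra.smul_def]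
    exact Submodule.smul_mem _ _ (Submodule.subset_span (Set.mem_insert_of_mem _ rfl))

/-! ### The residue field of `𝒪₀` is `𝔽₃` -/

/-- Every element of `𝒪₀` is congruent to a natural number modulo `𝔪`. -/
theorem exists_nat_sub_mem_maximalIdeal (x : O₀ ι e) : ∃ n : ℕ, x - n ∈ maximalIdeal (O₀ ι e) := by
  obtain ⟨a, b, rfl⟩ := exists_padicInt_add_mul_piO ι e x
  refine ⟨(PadicInt.toZMod a).val, ?_⟩
  have ha : a - ((PadicInt.toZMod a).val : ℤ_[3]) ∈ maximalIdeal ℤ_[3] := by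
    have h := PadicInt.toZMod_spec a
    rwa [ZMod.cast_eq_val] at h
  rw [mem_maximalIdeal_O₀_iff, map_sub, map_add, map_mul, j₀_algebraMap, j₀_algebraMap, j₀_piO,
    map_natCast]
  have h1 : ‖((a : ℚ_[3]) : PadicAlgCl 3) - ((PadicInt.toZMod a).val : PadicAlgCl 3)‖ < 1 := by
    have : ((a : ℚ_[3]) : PadicAlgCl 3) - ((PadicInt.toZMod a).val : PadicAlgCl 3) =
        (((a - ((PadicInt.toZMod a).val : ℤ_[3]) : ℤ_[3]) : ℚ_[3]) : PadicAlgCl 3) := by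
      push_cast
      simp
    rw [this, PadicAlgCl.norm_extends, PadicInt.padic_norm_e_of_padicInt]
    exact PadicInt.mem_nonunits.mp ha
  have h2 : ‖((b : ℚ_[3]) : PadicAlgCl 3) * piE ι e‖ < 1 := by
    rw [norm_mul, PadicAlgCl.norm_extends, PadicInt.padic_norm_e_of_padicInt]
    exact mul_lt_one_of_nonneg_of_lt_one_right b.norm_le_one (norm_nonneg _) (norm_piE_lt_one ι e)
  calc ‖((a : ℚ_[3]) : PadicAlgCl 3) + ((b : ℚ_[3]) : PadicAlgCl 3) * piE ι e - ((PadicInt.toZMod a).val : PadicAlgCl 3)‖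
      = ‖(((a : ℚ_[3]) : PadicAlgCl 3) - ((PadicInt.toZMod a).val : PadicAlgCl 3)) +
          ((b : ℚ_[3]) : PadicAlgCl 3) * piE ι e‖ := by ring_nf
    _ ≤ max _ _ := IsUltrametricDist.norm_add_le_max _ _
    _ < 1 := max_lt h1 h2

/-- `3 ∈ 𝔪_{𝒪₀}`: the residue field has characteristic `3`. -/
instance instCharPResidueFieldO₀ : CharP (ResidueField (O₀ ι e)) 3 := by
  refine (CharP.charP_iff_prime_eq_zero Nat.prime_three).mpr ?_
  rw [← map_natCast (residue (O₀ ι e)) 3, residue_eq_zero_iff]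
  exact intermediateFieldIntegers.natCast_mem_maximalIdeal _

/-- `𝔽₃ → 𝒪₀/𝔪` is bijective. -/
theorem castHom_residueField_bijective :
    Function.Bijective (ZMod.castHom (dvd_refl 3) (ResidueField (O₀ ι e))) := by
  refine ⟨(ZMod.castHom (dvd_refl 3) (ResidueField (O₀ ι e))).injective, fun r => ?_⟩
  obtain ⟨x, rfl⟩ := residue_surjective r
  obtain ⟨n, hn⟩ := exists_nat_sub_mem_maximalIdeal ι e x
  refine ⟨n, ?_⟩
  rw [map_natCast, ← map_natCast (residue (O₀ ι e)) n, eq_comm, ← sub_eq_zero, ← map_sub,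
    residue_eq_zero_iff]
  exact hn

/-- `𝒪₀/𝔪 ≅ 𝔽₃`. -/
def residueFieldEquiv : ZMod 3 ≃+* ResidueField (O₀ ι e) :=
  RingEquiv.ofBijective _ (castHom_residueField_bijective ι e)

/-- The residue map `𝒪₀ → 𝔽₃`. -/
def toZMod3 : O₀ ι e →+* ZMod 3 := (residueFieldEquiv ι e).symm.toRingHom.comp (residue (O₀ ι e))

/-- `𝔽₃` as an `𝒪₀`-algebra through the residue map. -/
instance instAlgebraO₀ZMod : Algebra (O₀ ι e) (ZMod 3) := (toZMod3 ι e).toAlgebra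

/-- The structure map `𝒪₀ → 𝔽₃` is the residue map `toZMod3`. -/
theorem algebraMap_O₀_ZMod_eq : algebraMap (O₀ ι e) (ZMod 3) = toZMod3 ι e := rfl

/-- **The residue field of `𝒪₀` is `𝔽₃`**: `𝒪₀ → 𝔽₃` is onto. -/
theorem algebraMap_O₀_ZMod_surjective : Function.Surjective (algebraMap (O₀ ι e) (ZMod 3)) :=
  (residueFieldEquiv ι e).symm.surjective.comp residue_surjective

/-- The kernel of `𝒪₀ → 𝔽₃` is the maximal ideal. -/
theorem ker_algebraMap_O₀_ZMod : RingHom.ker (algebraMap (O₀ ι e) (ZMod 3)) = maximalIdeal (O₀ ι e) := by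
  ext x
  rw [RingHom.mem_ker, algebraMap_O₀_ZMod_eq, toZMod3, RingHom.comp_apply, RingEquiv.toRingHom_eq_coe,
    RingEquiv.coe_toRingHom, RingEquiv.map_eq_zero_iff, residue_eq_zero_iff]

/-- `residue = (𝔽₃ ≅ 𝒪₀/𝔪) ∘ (𝒪₀ → 𝔽₃)`. -/
theorem residueFieldEquiv_algebraMap (x : O₀ ι e) :
    residueFieldEquiv ι e (algebraMap (O₀ ι e) (ZMod 3) x) = residue (O₀ ι e) x := by
  rw [algebraMap_O₀_ZMod_eq, toZMod3, RingHom.comp_apply, RingEquiv.toRingHom_eq_coe, RingEquiv.coe_toRingHom,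
    RingEquiv.apply_symm_apply]

/-- **Summary (registered helper goal of `stub_point`)**: for every `(ι, e)` the ring `𝒪₀ = O₀ ι e`
has residue field `𝔽₃` — its structure map to `ZMod 3` is onto — and is `ℤ₃ ⊕ ℤ₃ π`. -/
theorem pointRing_residue_surjective : ∀ (ι : PadicAlgCl 3 ≃+* ℂ) (e : K →+* ℂ), Function.Surjective (algebraMap (O₀ ι e) (ZMod 3)) ∧ ∀ x : O₀ ι e, ∃ a b : ℤ_[3], x = algebraMap ℤ_[3] (O₀ ι e) a + algebraMap ℤ_[3] (O₀ ι e) b * piO ι e :=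
  fun ι e => ⟨algebraMap_O₀_ZMod_surjective ι e, exists_padicInt_add_mul_piO ι e⟩

end

end Summit.Langlands.Langlands.Cruxes.MuOrdinaryFamilyRT.FreeSeedSmoothRt
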